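import Mathlib.GroupTheory.Perm.Cycle.Concrete
import Mathlib.GroupTheory.Perm.Cycle.Basic
import Mathlib.GroupTheory.Perm.Support
import Mathlib.GroupTheory.OrderOfElement
import HarnessLib

/-!
# Route PolyaContinued — support item `SignedCoverLittle` (stmt-ValiantsHypothesis-7426):
# ear lemma, part A — cyclic distance and directed paths along a cyclic permutation

Toolkit for the two-circuit ear lemma (step (EAR) of the paper proof `proof-LabelTransfer.md` of
the label-transfer principle, to which the item was reduced in
`PolyaContinuedSignedCoverLittleReduction.lean`). A cyclic permutation `σ` of a finite type is a
directed circuit on its support; we need to speak about the directed `σ`-path from `x` to `y`.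

* `cdist σ x v` — the least `t` with `(σ ^ t) x = v` (and `0` if there is none); on the support of
  a cycle: `pow_cdist_apply`, `cdist_lt_orderOf`, `cdist_eq_of_pow_eq` (uniqueness below the
  order), `cdist_apply_eq` (one step: `+ 1` modulo the order);
* `pathSet σ x y` — the vertices `v` of the support with `cdist σ x v < cdist σ x y`, i.e. the
  tails of the arcs of the directed `σ`-path from `x` to `y` (`x` included iff `x ≠ y`, `y`
  excluded): `start_mem_pathSet_iff`, `notMem_pathSet_end`, closure under `σ` before the end
  (`apply_mem_pathSet`), entry only at the start (`mem_pathSet_of_apply_mem`), induction along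
  the path (`pathSet_induction`), and the order trichotomy on a circuit
  (`mem_pathSet_iff_notMem_pathSet`).

Pure permutation combinatorics (any finite type); no graph appears yet.
-/

namespace Summit.ValiantsHypothesis.PolyaContinued

open Equiv Equiv.Perm Finset

variable {α : Type*} [Fintype α] [DecidableEq α]

/-! ### Powers of a cycle applied to a point of its support -/

/-- On the support of a cyclic permutation, `t ↦ (σ ^ t) x` is injective below the order.
[folklore] -/
theorem pow_apply_injOn {σ : Perm α} (hσ : σ.IsCycle) {x : α} (hx : x ∈ σ.support) {s t : ℕ}
    (hs : s < orderOf σ) (ht : t < orderOf σ) (h : (σ ^ s) x = (σ ^ t) x) : s = t :=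
  pow_injOn_Iio_orderOf (Set.mem_Iio.2 hs) (Set.mem_Iio.2 ht)
    (hσ.pow_eq_pow_iff.2 ⟨x, mem_support.1 hx, h⟩)

/-- Two points of the support of a cycle are joined by a power below the order. [folklore] -/
theorem exists_pow_apply_eq_lt {σ : Perm α} (hσ : σ.IsCycle) {x v : α} (hx : x ∈ σ.support)
    (hv : v ∈ σ.support) : ∃ t, t < orderOf σ ∧ (σ ^ t) x = v := by
  obtain ⟨i, hi⟩ := hσ.exists_pow_eq (mem_support.1 hx) (mem_support.1 hv)
  exact ⟨i % orderOf σ, Nat.mod_lt _ (orderOf_pos σ), by rwa [pow_mod_orderOf]⟩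

/-! ### Cyclic distance -/

open Classical in
/-- **Cyclic distance** `cdist σ x v`: the least `t : ℕ` with `(σ ^ t) x = v`, and `0` if `v` is
not on the `σ`-orbit of `x`. [folklore] -/
noncomputable def cdist (σ : Perm α) (x v : α) : ℕ :=
  if h : ∃ t : ℕ, (σ ^ t) x = v then Nat.find h else 0

omit [Fintype α] in
/-- The defining property of the cyclic distance. [folklore] -/
theorem pow_cdist_apply {σ : Perm α} {x v : α} (h : ∃ t : ℕ, (σ ^ t) x = v) :
    (σ ^ cdist σ x v) x = v := by
  classical
  unfold cdist
  rw [dif_pos h]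
  exact Nat.find_spec h

omit [Fintype α] in
/-- Minimality of the cyclic distance. [folklore] -/
theorem cdist_le_of_pow_apply {σ : Perm α} {x v : α} {t : ℕ} (ht : (σ ^ t) x = v) :
    cdist σ x v ≤ t := by
  classical
  unfold cdist
  rw [dif_pos ⟨t, ht⟩]
  exact Nat.find_min' _ ht

omit [Fintype α] in
/-- `cdist σ x x = 0`. [folklore] -/
theorem cdist_self (σ : Perm α) (x : α) : cdist σ x x = 0 :=
  Nat.le_zero.1 (cdist_le_of_pow_apply (t := 0) rfl)

/-- On the support of a cycle the cyclic distance is below the order. [folklore] -/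
theorem cdist_lt_orderOf {σ : Perm α} (hσ : σ.IsCycle) {x v : α} (hx : x ∈ σ.support)
    (hv : v ∈ σ.support) : cdist σ x v < orderOf σ := by
  obtain ⟨t, ht, htv⟩ := exists_pow_apply_eq_lt hσ hx hv
  exact lt_of_le_of_lt (cdist_le_of_pow_apply htv) ht

/-- On the support of a cycle, `(σ ^ cdist σ x v) x = v`. [folklore] -/
theorem pow_cdist_apply_of_mem {σ : Perm α} (hσ : σ.IsCycle) {x v : α} (hx : x ∈ σ.support)
    (hv : v ∈ σ.support) : (σ ^ cdist σ x v) x = v :=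
  pow_cdist_apply (let ⟨t, _, ht⟩ := exists_pow_apply_eq_lt hσ hx hv; ⟨t, ht⟩)

/-- Uniqueness: a power below the order taking `x` to `v` IS the cyclic distance. [folklore] -/
theorem cdist_eq_of_pow_apply {σ : Perm α} (hσ : σ.IsCycle) {x v : α} (hx : x ∈ σ.support)
    {t : ℕ} (ht : t < orderOf σ) (h : (σ ^ t) x = v) : cdist σ x v = t := by
  have hv : v ∈ σ.support := by rw [← h]; exact pow_apply_mem_support.2 hx
  exact pow_apply_injOn hσ hx (cdist_lt_orderOf hσ hx hv) ht
    ((pow_cdist_apply_of_mem hσ hx hv).trans h.symm)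

/-- `cdist σ x v = 0` iff `v = x` (on the support of a cycle). [folklore] -/
theorem cdist_eq_zero_iff {σ : Perm α} (hσ : σ.IsCycle) {x v : α} (hx : x ∈ σ.support)
    (hv : v ∈ σ.support) : cdist σ x v = 0 ↔ v = x := by
  constructor
  · intro h
    have := pow_cdist_apply_of_mem hσ hx hv
    rw [h, pow_zero, Perm.one_apply] at this
    exact this.symm
  · rintro rfl
    exact cdist_self σ v

/-- Points of the support at the same cyclic distance from `x` coincide. [folklore] -/
theorem eq_of_cdist_eq {σ : Perm α} (hσ : σ.IsCycle) {x v w : α} (hx : x ∈ σ.support)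
    (hv : v ∈ σ.support) (hw : w ∈ σ.support) (h : cdist σ x v = cdist σ x w) : v = w := by
  rw [← pow_cdist_apply_of_mem hσ hx hv, ← pow_cdist_apply_of_mem hσ hx hw, h]

/-- One step along the circuit: `cdist σ x (σ v) = (cdist σ x v + 1) mod (order)`. [folklore] -/
theorem cdist_apply_eq {σ : Perm α} (hσ : σ.IsCycle) {x v : α} (hx : x ∈ σ.support)
    (hv : v ∈ σ.support) : cdist σ x (σ v) = (cdist σ x v + 1) % orderOf σ := by
  refine cdist_eq_of_pow_apply hσ hx (Nat.mod_lt _ (orderOf_pos σ)) ?_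
  rw [pow_mod_orderOf, pow_succ', Perm.mul_apply, pow_cdist_apply_of_mem hσ hx hv]

/-- One step along the circuit, away from the base point: if `σ v ≠ x` then
`cdist σ x (σ v) = cdist σ x v + 1`. [folklore] -/
theorem cdist_apply_eq_succ {σ : Perm α} (hσ : σ.IsCycle) {x v : α} (hx : x ∈ σ.support)
    (hv : v ∈ σ.support) (hne : σ v ≠ x) : cdist σ x (σ v) = cdist σ x v + 1 := by
  rw [cdist_apply_eq hσ hx hv]
  apply Nat.mod_eq_of_lt
  have hle : cdist σ x v + 1 ≤ orderOf σ := cdist_lt_orderOf hσ hx hv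
  rcases hle.lt_or_eq with h | h
  · exact h
  · exfalso
    apply hne
    have := pow_cdist_apply_of_mem hσ hx hv
    rw [← this, ← Perm.mul_apply, ← pow_succ', h, pow_orderOf_eq_one, Perm.one_apply]

/-- If `σ v = x` then `v` is the last point of the circuit: `cdist σ x v + 1 = orderOf σ`.
[folklore] -/
theorem cdist_succ_eq_orderOf {σ : Perm α} (hσ : σ.IsCycle) {x v : α} (hx : x ∈ σ.support)
    (hv : v ∈ σ.support) (heq : σ v = x) : cdist σ x v + 1 = orderOf σ := by
  have h := cdist_apply_eq hσ hx hv
  rw [heq, cdist_self] at h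
  -- `(d + 1) % o = 0` with `d + 1 ≤ o` forces `d + 1 = o`
  have hle : cdist σ x v + 1 ≤ orderOf σ := cdist_lt_orderOf hσ hx hv
  rcases hle.lt_or_eq with hlt | heq'
  · rw [Nat.mod_eq_of_lt hlt] at h
    exact absurd h.symm (Nat.succ_ne_zero _)
  · exact heq'

/-! ### Directed paths along a circuit -/

/-- **The directed `σ`-path from `x` to `y`**, as the set of TAILS of its arcs: the points `v` of
the support with `cdist σ x v < cdist σ x y` (so `x, σ x, …` up to but excluding `y`; empty if
`x = y`). [folklore] -/
noncomputable def pathSet (σ : Perm α) (x y : α) : Finset α :=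
  σ.support.filter fun v => cdist σ x v < cdist σ x y

/-- Membership in a path. [folklore] -/
theorem mem_pathSet {σ : Perm α} {x y v : α} :
    v ∈ pathSet σ x y ↔ v ∈ σ.support ∧ cdist σ x v < cdist σ x y :=
  Finset.mem_filter

/-- Paths lie in the support. [folklore] -/
theorem mem_support_of_mem_pathSet {σ : Perm α} {x y v : α} (h : v ∈ pathSet σ x y) :
    v ∈ σ.support :=
  (mem_pathSet.1 h).1

/-- The end point is not a tail of the path. [folklore] -/
theorem notMem_pathSet_end (σ : Perm α) (x y : α) : y ∉ pathSet σ x y :=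
  fun h => lt_irrefl _ (mem_pathSet.1 h).2

/-- The start is a tail of the path iff the path is nonempty, i.e. `x ≠ y`. [folklore] -/
theorem start_mem_pathSet_iff {σ : Perm α} (hσ : σ.IsCycle) {x y : α} (hx : x ∈ σ.support)
    (hy : y ∈ σ.support) : x ∈ pathSet σ x y ↔ x ≠ y := by
  rw [mem_pathSet, cdist_self, pos_iff_ne_zero, Ne, cdist_eq_zero_iff hσ hx hy]
  exact ⟨fun h e => h.2 e.symm, fun h => ⟨hx, fun e => h e.symm⟩⟩

/-- A path is closed under `σ` until it reaches its end. [folklore] -/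
theorem apply_mem_pathSet {σ : Perm α} (hσ : σ.IsCycle) {x y v : α} (hx : x ∈ σ.support)
    (hv : v ∈ pathSet σ x y) (hne : σ v ≠ y) : σ v ∈ pathSet σ x y := by
  obtain ⟨hvs, hlt⟩ := mem_pathSet.1 hv
  have hy : y ∈ σ.support := by
    by_contra hy
    -- `cdist σ x y = 0` would make `hlt` impossible
    have : cdist σ x y = 0 := by
      classical
      unfold cdist
      rw [dif_neg]
      rintro ⟨t, ht⟩
      exact hy (ht ▸ pow_apply_mem_support.2 hx)
    omega
  refine mem_pathSet.2 ⟨apply_mem_support.2 hvs, ?_⟩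
  by_cases hvx : σ v = x
  · rw [hvx, cdist_self]
    exact lt_of_le_of_lt (Nat.zero_le _) hlt
  · rw [cdist_apply_eq_succ hσ hx hvs hvx]
    rcases (Nat.succ_le_of_lt hlt).lt_or_eq with h | h
    · exact h
    · exact absurd (eq_of_cdist_eq hσ hx (apply_mem_support.2 hvs) hy
        ((cdist_apply_eq_succ hσ hx hvs hvx).trans h)) hne

/-- A path can only be entered at its start: if `σ a` is a tail of the path from `x` to `y` other
than `x` itself, then so is `a`. [folklore] -/
theorem mem_pathSet_of_apply_mem {σ : Perm α} (hσ : σ.IsCycle) {x y a : α} (hx : x ∈ σ.support)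
    (ha : a ∈ σ.support) (h : σ a ∈ pathSet σ x y) (hne : σ a ≠ x) : a ∈ pathSet σ x y := by
  obtain ⟨-, hlt⟩ := mem_pathSet.1 h
  rw [cdist_apply_eq_succ hσ hx ha hne] at hlt
  exact mem_pathSet.2 ⟨ha, by omega⟩

/-- **Induction along a path**: a property holding at the start (if the path is nonempty) and
propagating along arcs of the path holds at every tail of the path. [folklore] -/
theorem pathSet_induction {σ : Perm α} (hσ : σ.IsCycle) {x y : α} (hx : x ∈ σ.support)
    {Q : α → Prop} (h0 : x ≠ y → Q x)
    (hstep : ∀ v ∈ pathSet σ x y, σ v ∈ pathSet σ x y → Q v → Q (σ v)) :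
    ∀ v ∈ pathSet σ x y, Q v := by
  -- induction on the cyclic distance from `x`
  suffices H : ∀ d : ℕ, ∀ v ∈ pathSet σ x y, cdist σ x v = d → Q v from
    fun v hv => H _ v hv rfl
  intro d
  induction d with
  | zero =>
    intro v hv hd
    have hvx : v = x := (cdist_eq_zero_iff hσ hx (mem_support_of_mem_pathSet hv)).1 hd
    subst hvx
    exact h0 fun hxy => notMem_pathSet_end σ v v (hxy ▸ hv)
  | succ d ih =>
    intro v hv hd
    obtain ⟨hvs, hlt⟩ := mem_pathSet.1 hv
    -- the predecessor `w = σ⁻¹ v` has `cdist = d` and lies on the path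
    set w := σ⁻¹ v with hw
    have hwv : σ w = v := σ.apply_symm_apply v
    have hws : w ∈ σ.support := apply_mem_support.1 (hwv.symm ▸ hvs)
    have hwx : σ w ≠ x := by
      rw [hwv]; rintro rfl; rw [cdist_self] at hd; exact Nat.succ_ne_zero _ hd.symm
    have hdw : cdist σ x w = d := by
      have := cdist_apply_eq_succ hσ hx hws hwx
      rw [hwv, hd] at this
      omega
    have hwp : w ∈ pathSet σ x y := mem_pathSet.2 ⟨hws, by omega⟩
    have := hstep w hwp (hwv ▸ hv) (ih w hwp hdw)
    rwa [hwv] at this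

/-- **Order on a circuit**: for two further points `a ≠ b` of the support, `a` lies on the path
from `x` to `b` iff `b` does not lie on the path from `x` to `a` (exactly one of them comes
first). [folklore] -/
theorem mem_pathSet_iff_notMem_pathSet {σ : Perm α} (hσ : σ.IsCycle) {x a b : α}
    (hx : x ∈ σ.support) (ha : a ∈ σ.support) (hb : b ∈ σ.support) (hab : a ≠ b) :
    a ∈ pathSet σ x b ↔ b ∉ pathSet σ x a := by
  rw [mem_pathSet, mem_pathSet]
  have hne : cdist σ x a ≠ cdist σ x b := fun h => hab (eq_of_cdist_eq hσ hx ha hb h)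
  constructor
  · rintro ⟨-, h⟩ ⟨-, h'⟩; omega
  · intro h; refine ⟨ha, ?_⟩
    by_contra h'
    exact h ⟨hb, by omega⟩

/-- Transitivity along a circuit: if `a` comes before `b` and `b` before `c` (from `x`), then `a`
comes before `c`. [folklore] -/
theorem mem_pathSet_trans {σ : Perm α} {x a b c : α} (hab : a ∈ pathSet σ x b)
    (hbc : b ∈ pathSet σ x c) : a ∈ pathSet σ x c := by
  rw [mem_pathSet] at *
  exact ⟨hab.1, hab.2.trans hbc.2⟩

/-- A path avoiding a point: if `b` is not a tail of the path from `x` to `c` and `b ≠ c`, then the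
whole path from `x` to `c` consists of tails of the path from `x` to `b`. [folklore] -/
theorem pathSet_subset_of_notMem {σ : Perm α} (hσ : σ.IsCycle) {x b c : α} (hx : x ∈ σ.support)
    (hb : b ∈ σ.support) (hc : c ∈ σ.support) (hbc : b ≠ c) (h : b ∉ pathSet σ x c) :
    pathSet σ x c ⊆ pathSet σ x b := by
  intro v hv
  have hcb : c ∈ pathSet σ x b := (mem_pathSet_iff_notMem_pathSet hσ hx hc hb hbc.symm).2 h
  exact mem_pathSet_trans hv hcb

end Summit.ValiantsHypothesis.PolyaContinued
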